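import Literature.MathematicalPhysics.QuantumFieldTheory.Balaban1983to89.T4RootedResidualGauge
import Literature.MathematicalPhysics.QuantumFieldTheory.Balaban1983to89.BlockAveragingExpMeanLogContinuous
import HarnessLib

/-!
# Route `FluctuationComparisonRegPrIntL` (stmt-QuantumFields-20520), LINE g18-1 S2β LAPLACE, letter (C3-c), I — THE SIGNED IN-BLOCK COMB TRANSPORTER:
# definitions, triviality at the roots, telescoping covariance, continuity ∕ measurability

Cell `ym3-torus` (HUMAN RULING D-0037 — YM₃ on T³ is ladder rung R3, not the Clay problem), width seat `ym3-torus-px21` g9; count-neutral helper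
(`--supports stmt-QuantumFields-20520`; this file carries DEFINITIONS — review lane).  0 `instance`, 0 `notation`, 0 `sorry`.

WHY.  The tubular chart (C3β″) is ✓`…S2BetaTreeGaugeChart.exists_tubularChart_of_treeGauge` (p736010) applied to a lattice TRANSPORTER satisfying the five
tree-gauge axioms.  lit `T4RootedResidualGauge.rootTransporter` has the right covariance but its coordinate paths use UNSIGNED steps `(x μ − a μ).val` and
wrap around the torus, so its comb is not killed.  This file defines the SIGNED variant (steps `(x μ).val − (a μ).val ∈ ℤ`, backward bonds inverted),
whose paths from the `k`-block centres stay inside the blocks ([Balaban1985Variational] p. 281 «exactly one gauge transformation u satisfying R̄₀uʲ = 1»;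
[Balaban1985RegularSpaces] (1.19)–(1.20)), and proves the lattice-free half of the axioms: `hg1`, `hgR`, `hcov` (telescoping), continuity, measurability.
Part II (block arithmetic: the comb set, `hkill`, `hloc`) and the instantiation follow.

HONEST SCOPE.  Lattice bookkeeping (path holonomies); nothing of Bałaban's analysis; (C3) ∕ LAPLACE ∕ S2β ∕ 20520 NOT proved; rung R3 — NOT d = 4, NOT infinite
volume, NOT a mass gap, NOT Clay.
-/

noncomputable section

open Function
open Literature.MathematicalPhysics.QuantumFieldTheory.Balaban1983to89
open Literature.MathematicalPhysics.QuantumFieldTheory.Balaban1983to89.T4RootedResidualGauge (shiftN lineHol lineHol_gaugeAct rootOf rootOf_embIter)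
open Literature.MathematicalPhysics.QuantumFieldTheory.Balaban1983to89.B15DeterminingSets (embIter)
open Literature.MathematicalPhysics.QuantumFieldTheory.Balaban1983to89.GaugeField (gaugeAct)

namespace Summit.QuantumFields.YangMills.Theorems.FluctuationComparisonRegPrIntLS2BetaSignedComb

variable {P : Params} {j : ℕ} {G : Type*} [GaugeGroup G]

/-! ## §1  Signed straight paths -/

/-- `x + n·e_μ` for an INTEGER `n`. [cite: Balaban1985Averaging, (8) p.19 (bookkeeping)] -/
def shiftZ (x : Site P j) (μ : Fin P.d) (n : ℤ) : Site P j := Function.update x μ (x μ + n)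

omit [GaugeGroup G] in
/-- Bookkeeping for the signed comb (see the module docstring). [cite: Balaban1985Averaging, (8) p.19 (bookkeeping)] -/
@[simp] theorem shiftZ_zero (x : Site P j) (μ : Fin P.d) : shiftZ x μ 0 = x := by simp [shiftZ]

omit [GaugeGroup G] in
/-- Bookkeeping for the signed comb (see the module docstring). [cite: Balaban1985Averaging, (8) p.19 (bookkeeping)] -/
theorem shiftZ_natCast (x : Site P j) (μ : Fin P.d) (n : ℕ) : shiftZ x μ (n : ℤ) = shiftN x μ n := by
  simp [shiftZ, shiftN]

omit [GaugeGroup G] in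
/-- Bookkeeping for the signed comb (see the module docstring). [cite: Balaban1985Averaging, (8) p.19 (bookkeeping)] -/
theorem shiftZ_apply_self (x : Site P j) (μ : Fin P.d) (n : ℤ) : shiftZ x μ n μ = x μ + n := by simp [shiftZ]

omit [GaugeGroup G] in
/-- Bookkeeping for the signed comb (see the module docstring). [cite: Balaban1985Averaging, (8) p.19 (bookkeeping)] -/
theorem shiftZ_apply_of_ne (x : Site P j) {μ ν : Fin P.d} (h : ν ≠ μ) (n : ℤ) : shiftZ x μ n ν = x ν := by
  simp [shiftZ, Function.update_of_ne h]

/-- The BACKWARD straight holonomy: `a, a − e_μ, …, a − n·e_μ`, each bond traversed against its orientation (inverted variable).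
[cite: Balaban1985Averaging, (8) p.19 (bookkeeping)] -/
def lineHolBack (U : GaugeField P j G) (a : Site P j) (μ : Fin P.d) : ℕ → G
  | 0 => 1
  | n + 1 => lineHolBack U a μ n * (U ⟨shiftZ a μ (-((n : ℤ) + 1)), μ⟩)⁻¹

/-- Bookkeeping for the signed comb (see the module docstring). [cite: Balaban1985Averaging, (8) p.19 (bookkeeping)] -/
@[simp] theorem lineHolBack_zero (U : GaugeField P j G) (a : Site P j) (μ : Fin P.d) : lineHolBack U a μ 0 = 1 := rfl

/-- Bookkeeping for the signed comb (see the module docstring). [cite: Balaban1985Averaging, (8) p.19 (bookkeeping)] -/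
theorem lineHolBack_succ (U : GaugeField P j G) (a : Site P j) (μ : Fin P.d) (n : ℕ) :
    lineHolBack U a μ (n + 1) = lineHolBack U a μ n * (U ⟨shiftZ a μ (-((n : ℤ) + 1)), μ⟩)⁻¹ := rfl

/-- The SIGNED straight holonomy from `a` along `μ` by `n ∈ ℤ` steps. [cite: Balaban1985Averaging, (8) p.19 (bookkeeping)] -/
def lineHolZ (U : GaugeField P j G) (a : Site P j) (μ : Fin P.d) : ℤ → G
  | Int.ofNat n => lineHol U a μ n
  | Int.negSucc n => lineHolBack U a μ (n + 1)

/-- Bookkeeping for the signed comb (see the module docstring). [cite: Balaban1985Averaging, (8) p.19 (bookkeeping)] -/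
@[simp] theorem lineHolZ_zero (U : GaugeField P j G) (a : Site P j) (μ : Fin P.d) : lineHolZ U a μ 0 = 1 := rfl

/-- Bookkeeping for the signed comb (see the module docstring). [cite: Balaban1985Averaging, (8) p.19 (bookkeeping)] -/
theorem lineHolZ_natCast (U : GaugeField P j G) (a : Site P j) (μ : Fin P.d) (n : ℕ) : lineHolZ U a μ (n : ℤ) = lineHol U a μ n := rfl

/-- Bookkeeping for the signed comb (see the module docstring). [cite: Balaban1985Averaging, (8) p.19 (bookkeeping)] -/
theorem lineHolZ_negSucc (U : GaugeField P j G) (a : Site P j) (μ : Fin P.d) (n : ℕ) :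
    lineHolZ U a μ (Int.negSucc n) = lineHolBack U a μ (n + 1) := rfl

/-- Telescoping along a backward line: `hol_{U^u} = u(a) · hol_U · u(end)⁻¹`, `end = a − n·e_μ`. [cite: Balaban1985Averaging, (8) p.19] -/
theorem lineHolBack_gaugeAct (u : GaugeTransf P j G) (U : GaugeField P j G) (a : Site P j) (μ : Fin P.d) :
    ∀ n : ℕ, lineHolBack (gaugeAct u U) a μ n = u a * lineHolBack U a μ n * (u (shiftZ a μ (-(n : ℤ))))⁻¹
  | 0 => by simp [lineHolBack]
  | n + 1 => by
      rw [lineHolBack_succ, lineHolBack_succ, lineHolBack_gaugeAct u U a μ n]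
      -- the backward bond `⟨a − (n+1)e_μ, μ⟩` runs from `a − (n+1)e_μ` to `a − n e_μ`
      have htgt : (⟨shiftZ a μ (-((n : ℤ) + 1)), μ⟩ : PBond P j).tgt = shiftZ a μ (-(n : ℤ)) := by
        funext ν
        show (Site.shift (shiftZ a μ (-((n : ℤ) + 1))) μ) ν = shiftZ a μ (-(n : ℤ)) ν
        by_cases hν : ν = μ
        · subst hν
          simp only [Site.shift, Function.update_self, shiftZ_apply_self]
          push_cast; ring
        · simp only [Site.shift, Function.update_of_ne hν, shiftZ_apply_of_ne _ hν]
      simp only [gaugeAct, htgt, mul_inv_rev, inv_inv]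
      have hcast : (-((n : ℤ) + 1)) = -(((n + 1 : ℕ) : ℤ)) := by push_cast; ring
      rw [hcast]
      simp only [mul_assoc, inv_mul_cancel_left]

/-- Telescoping along a signed line. [cite: Balaban1985Averaging, (8) p.19] -/
theorem lineHolZ_gaugeAct (u : GaugeTransf P j G) (U : GaugeField P j G) (a : Site P j) (μ : Fin P.d) :
    ∀ n : ℤ, lineHolZ (gaugeAct u U) a μ n = u a * lineHolZ U a μ n * (u (shiftZ a μ n))⁻¹
  | Int.ofNat n => by
      rw [show (Int.ofNat n : ℤ) = (n : ℤ) from rfl, lineHolZ_natCast, lineHolZ_natCast, lineHol_gaugeAct, shiftZ_natCast]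
  | Int.negSucc n => by
      rw [lineHolZ_negSucc, lineHolZ_negSucc, lineHolBack_gaugeAct, Int.negSucc_eq, Nat.cast_succ]

/-! ## §2  Signed coordinate paths and the comb transporter -/

/-- The SIGNED coordinate-ordered path holonomy from `a` aimed at `x` through the directions of `l`: along `μ` by the signed number of steps
`(x μ).val − (a μ).val`, then the rest from the point reached. [cite: Balaban1985Averaging, (8) p.19 (bookkeeping)] -/
def pathHolZ (U : GaugeField P j G) : Site P j → Site P j → List (Fin P.d) → G
  | _, _, [] => 1
  | a, x, μ :: l => lineHolZ U a μ (((x μ).val : ℤ) - ((a μ).val : ℤ)) *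
      pathHolZ U (shiftZ a μ (((x μ).val : ℤ) - ((a μ).val : ℤ))) x l

/-- The end point of the signed coordinate path. [cite: Balaban1985Averaging, (8) p.19 (bookkeeping)] -/
def pathEndZ : Site P j → Site P j → List (Fin P.d) → Site P j
  | a, _, [] => a
  | a, x, μ :: l => pathEndZ (shiftZ a μ (((x μ).val : ℤ) - ((a μ).val : ℤ))) x l

omit [GaugeGroup G] in
/-- After the `μ`-segment the `μ`-coordinate is that of `x`. [cite: Balaban1985Averaging, (8) p.19 (bookkeeping)] -/
theorem shiftZ_steps_apply (a x : Site P j) (μ ν : Fin P.d) :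
    shiftZ a μ (((x μ).val : ℤ) - ((a μ).val : ℤ)) ν = if ν = μ then x ν else a ν := by
  by_cases h : ν = μ
  · subst h
    rw [shiftZ_apply_self, if_pos rfl]
    push_cast
    rw [ZMod.natCast_zmod_val, ZMod.natCast_zmod_val]
    abel
  · rw [shiftZ_apply_of_ne _ h, if_neg h]

omit [GaugeGroup G] in
/-- The end point through a duplicate-free list: listed coordinates are `x`'s, the others `a`'s. [cite: Balaban1985Averaging, (8) p.19 (bookkeeping)] -/
theorem pathEndZ_apply_of_nodup : ∀ (a x : Site P j) (l : List (Fin P.d)), l.Nodup → ∀ ν, pathEndZ a x l ν = if ν ∈ l then x ν else a ν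
  | a, x, [], _, ν => by simp [pathEndZ]
  | a, x, μ :: l, hl, ν => by
      rw [List.nodup_cons] at hl
      rw [pathEndZ, pathEndZ_apply_of_nodup _ x l hl.2 ν, shiftZ_steps_apply]
      by_cases hν : ν ∈ l
      · have hνμ : ν ≠ μ := fun h => hl.1 (h ▸ hν)
        simp [hν]
      · by_cases hνμ : ν = μ
        · subst hνμ; simp [hν]
        · simp [hν, hνμ]

omit [GaugeGroup G] in
/-- The full signed coordinate path ends at its target. [cite: Balaban1985Averaging, (8) p.19 (bookkeeping)] -/
theorem pathEndZ_finRange (a x : Site P j) : pathEndZ a x (List.finRange P.d) = x := by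
  funext ν
  rw [pathEndZ_apply_of_nodup a x _ (List.nodup_finRange P.d) ν, if_pos (List.mem_finRange ν)]

/-- The signed path from `x` aimed at `x` is trivial. [cite: Balaban1985Averaging, (8) p.19 (bookkeeping)] -/
theorem pathHolZ_self : ∀ (U : GaugeField P j G) (x : Site P j) (l : List (Fin P.d)), pathHolZ U x x l = 1
  | U, x, [] => rfl
  | U, x, μ :: l => by
      rw [pathHolZ, sub_self, lineHolZ_zero, shiftZ_zero, pathHolZ_self U x l, one_mul]

/-- The unit configuration has trivial backward holonomies. [cite: Balaban1985Averaging, (8) p.19 (bookkeeping)] -/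
theorem lineHolBack_one (a : Site P j) (μ : Fin P.d) : ∀ n : ℕ, lineHolBack (1 : GaugeField P j G) a μ n = 1
  | 0 => rfl
  | n + 1 => by
      rw [lineHolBack_succ, lineHolBack_one a μ n, one_mul]
      show ((1 : GaugeField P j G) _)⁻¹ = 1
      exact inv_one

/-- The unit configuration has trivial signed path holonomies. [cite: Balaban1985Averaging, (8) p.19 (bookkeeping)] -/
theorem lineHolZ_one (a : Site P j) (μ : Fin P.d) : ∀ n : ℤ, lineHolZ (1 : GaugeField P j G) a μ n = 1
  | Int.ofNat n => by
      rw [show (Int.ofNat n : ℤ) = (n : ℤ) from rfl, lineHolZ_natCast]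
      exact T4RootedResidualGauge.lineHol_one a μ n
  | Int.negSucc n => by
      rw [lineHolZ_negSucc, lineHolBack_one]

/-- Bookkeeping for the signed comb (see the module docstring). [cite: Balaban1985Averaging, (8) p.19 (bookkeeping)] -/
theorem pathHolZ_one : ∀ (a x : Site P j) (l : List (Fin P.d)), pathHolZ (1 : GaugeField P j G) a x l = 1
  | _, _, [] => rfl
  | a, x, μ :: l => by rw [pathHolZ, lineHolZ_one, pathHolZ_one, one_mul]

/-- ★ **TELESCOPING ALONG A SIGNED PATH**: `hol_{U^u}(a → x) = u(a) · hol_U(a → x) · u(end)⁻¹`. [cite: Balaban1985Averaging, (8) p.19] -/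
theorem pathHolZ_gaugeAct (u : GaugeTransf P j G) (U : GaugeField P j G) :
    ∀ (a x : Site P j) (l : List (Fin P.d)), pathHolZ (gaugeAct u U) a x l = u a * pathHolZ U a x l * (u (pathEndZ a x l))⁻¹
  | a, x, [] => by simp [pathHolZ, pathEndZ]
  | a, x, μ :: l => by
      rw [pathHolZ, pathHolZ, pathEndZ, lineHolZ_gaugeAct, pathHolZ_gaugeAct u U _ x l]
      simp only [mul_assoc, inv_mul_cancel_left]

/-- **THE SIGNED COMB TRANSPORTER** of level `k`: the signed coordinate-path holonomy from the centre of the `k`-block of `x` to `x`.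
[cite: Balaban1985Variational, (19) p.281; Balaban1985RegularSpaces, (1.19) p.24] -/
def combTransporter (k : ℕ) (U : GaugeField P 0 G) : GaugeTransf P 0 G := fun x => pathHolZ U (rootOf k x) x (List.finRange P.d)

/-- `hg1`: the unit configuration has the trivial transporter. [cite: Balaban1985Variational, (19) p.281 (bookkeeping)] -/
theorem combTransporter_one (k : ℕ) : combTransporter k (1 : GaugeField P 0 G) = fun _ => 1 := by
  funext x; exact pathHolZ_one _ _ _

/-- `hgR`: the transporter is trivial at the roots (block centres). [cite: Balaban1985Variational, (19) p.281 (bookkeeping)] -/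
theorem combTransporter_embIter {k : ℕ} (hk : k ≤ P.m + P.K) (U : GaugeField P 0 G) (y : Site P k) :
    combTransporter k U (embIter k y) = 1 := by
  unfold combTransporter
  rw [rootOf_embIter hk, pathHolZ_self]

/-- ★ `hcov`: COVARIANCE `g_{U^u}(x) = u(root x) · g_U(x) · u(x)⁻¹` for every gauge transformation `u`; for root-trivial `u` this is the tree-gauge
axiom `g (u • U) x = g U x · (u x)⁻¹`. [cite: Balaban1985Averaging, (8) p.19] -/
theorem combTransporter_gaugeAct (k : ℕ) (u : GaugeTransf P 0 G) (U : GaugeField P 0 G) (x : Site P 0) :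
    combTransporter k (gaugeAct u U) x = u (rootOf k x) * combTransporter k U x * (u x)⁻¹ := by
  unfold combTransporter
  rw [pathHolZ_gaugeAct, pathEndZ_finRange]

/-- Bookkeeping for the signed comb (see the module docstring). [cite: Balaban1985Averaging, (8) p.19 (bookkeeping)] -/
theorem combTransporter_gaugeAct_of_rootTrivial (k : ℕ) {u : GaugeTransf P 0 G} (hu : ∀ y : Site P k, u (embIter k y) = 1)
    (U : GaugeField P 0 G) (x : Site P 0) : combTransporter k (gaugeAct u U) x = combTransporter k U x * (u x)⁻¹ := by
  rw [combTransporter_gaugeAct, show u (rootOf k x) = 1 from hu _, one_mul]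

/-! ## §3  Continuity and measurability -/

section Regularity

variable [TopologicalSpace G] [IsTopologicalGroup G]

/-- Bookkeeping for the signed comb (see the module docstring). [cite: Balaban1985Averaging, (8) p.19 (bookkeeping)] -/
theorem continuous_lineHol (a : Site P j) (μ : Fin P.d) : ∀ n : ℕ, Continuous fun U : GaugeField P j G => lineHol U a μ n
  | 0 => by simpa using continuous_const
  | n + 1 => by
      simp only [T4RootedResidualGauge.lineHol_succ]
      exact (continuous_lineHol a μ n).mul (continuous_apply _)

/-- Bookkeeping for the signed comb (see the module docstring). [cite: Balaban1985Averaging, (8) p.19 (bookkeeping)] -/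
theorem continuous_lineHolBack (a : Site P j) (μ : Fin P.d) : ∀ n : ℕ, Continuous fun U : GaugeField P j G => lineHolBack U a μ n
  | 0 => by simpa [lineHolBack] using continuous_const
  | n + 1 => by
      simp only [lineHolBack_succ]
      exact (continuous_lineHolBack a μ n).mul (continuous_apply _).inv

/-- Bookkeeping for the signed comb (see the module docstring). [cite: Balaban1985Averaging, (8) p.19 (bookkeeping)] -/
theorem continuous_lineHolZ (a : Site P j) (μ : Fin P.d) : ∀ n : ℤ, Continuous fun U : GaugeField P j G => lineHolZ U a μ n
  | Int.ofNat n => by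
      simp only [show (Int.ofNat n : ℤ) = (n : ℤ) from rfl, lineHolZ_natCast]
      exact continuous_lineHol a μ n
  | Int.negSucc n => by
      simp only [lineHolZ_negSucc]
      exact continuous_lineHolBack a μ (n + 1)

/-- Bookkeeping for the signed comb (see the module docstring). [cite: Balaban1985Averaging, (8) p.19 (bookkeeping)] -/
theorem continuous_pathHolZ : ∀ (a x : Site P j) (l : List (Fin P.d)), Continuous fun U : GaugeField P j G => pathHolZ U a x l
  | _, _, [] => by simpa [pathHolZ] using continuous_const
  | a, x, μ :: l => by
      simp only [pathHolZ]
      exact (continuous_lineHolZ a μ _).mul (continuous_pathHolZ _ x l)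

/-- The comb transporter is continuous (jointly in all its values: finite product topology). [folklore] -/
theorem continuous_combTransporter (k : ℕ) : Continuous (fun U : GaugeField P 0 G => fun x : Site P 0 => combTransporter k U x) :=
  continuous_pi fun x => by unfold combTransporter; exact continuous_pathHolZ _ _ _

end Regularity

end Summit.QuantumFields.YangMills.Theorems.FluctuationComparisonRegPrIntLS2BetaSignedComb

end
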